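import Summits.HodgeConjecture.CorCM.AbelianTwoPowerSubgroupInduction
import Literature.AlgebraicGeometry.Pohlmann1968.CMTypeRankCharactersNumberField
import HarnessLib

/-!
# Subgroup induction, CHARACTER form: a primitive CM set on a subgroup through complex conjugation, killed by an
# odd character of the whole group, induces a PRIMITIVE DEGENERATE CM type

COR-CM (cell `pub-hodgecm2`), binder seat b04 (gen 18), count-neutral claim ABELIAN-ODD-PART, part I.
KERNEL ONLY: theorems; no definition, no named fact, no `sorry`.  `HC_CM` is neither used nor claimed.

Gen 16 (`CorCM/AbelianTwoPowerSubgroupInduction`, `SubgroupInduction.exists_finset_of_subgroupModel`) induces a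
primitive CM set from a subgroup `G' ∋ c` keeping BALANCE over a subgroup `H ∌ c` — the Weil-type mechanism, which by
gen 12 (`AbelianTwoPower.not_isNondegenerate_iff_exists_fibres_balanced`) is the ONLY source of degeneracy when
`[K:ℚ]` is a power of `2`.  When `[K:ℚ] = 2^{a+1} m` has an odd part `m > 1`, degenerate types that are balanced over
NO subgroup occur (gen 12's inflated block types on cyclic groups; the `ℤ/2 × (ℤ/p)²` atom of part II: every
subgroup avoiding `c` has odd order), and the invariant to transport is Kubota's: an ODD character `χ` (`χ(c) = −1`)
with `Σ_{g ∈ T} χ(g) = 0` [Kubota1965, §4 Lemma 2].  Since `χ` is a character of the WHOLE group, no character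
extension is needed: the induced set is `T₀` on `G'` and `r_q · T₁` on the coset with representative `r_q`, and
`Σ_T χ = Σ_{T₀} χ + Σ_{q ≠ 1} χ(r_q) Σ_{T₁} χ = 0`.

* §1 **`exists_finset_of_subgroup_char`** (any finite commutative group `G`, subgroup `G' ∋ c`, `T₀, T₁ ⊆ G'` CM
  sets for `c` on `G'`, `T₀` with trivial stabiliser in `G'` and not a `G'`-translate of `T₁`, `χ` a character of
  `G` vanishing on `T₀` and on `T₁`): a CM set `T ⊆ G` for `c` with TRIVIAL stabiliser and `Σ_T χ = 0`.
* §2 **`exists_isPrimitive_not_isNondegenerate_of_galoisFinset_char`** (`K/ℚ` Galois CM with commutative Galois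
  group): a CM set `T ⊆ Gal(K/ℚ)` with trivial stabiliser on which an odd character vanishes gives the PRIMITIVE CM
  type `Φ = {σ_g : g ∈ T}` (Shimura §8.2 Prop. 26 as `isPrimitive_iff_forall_eq`), DEGENERATE by Kubota's Lemma 2
  (tree `Pohlmann1968.isNondegenerate_iff_forall_oddCharacters`).
* §3 **`exists_isPrimitive_not_isNondegenerate_of_subgroup_char`** (§1 + §2 on `Gal(K/ℚ)`) and the realisation
  form **`exists_simple_degenerate_of_subgroup_char`** (a SIMPLE CM abelian variety of dimension `[K:ℚ]/2` with an
  exceptional Hodge class on a power; Shimura's existence theorem = tree `cmAbelianVarietyRealised_holds`).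

Parts II/III supply the two structural atom families through `c` of a non-cyclic abelian Galois group whose order
has an odd part, and the classification of the abelian CM fields all of whose simple CM abelian varieties are
nondegenerate.

## References

* [Kubota1965] T. Kubota, *On the field extension by complex multiplication*, Trans. AMS 118 (1965), §4 Lemma 2.
* [Shimura1998] G. Shimura, *Abelian Varieties with Complex Multiplication and Modular Functions*, §6.2 Thm. 3,
  §8.1, §8.2 Prop. 26, §18.2 Lemma.
* [Gordon1999HodgeAVSurvey] B. B. Gordon, *A survey of the Hodge conjecture for abelian varieties*, Prop. 9.4.1,
  §9.4.2, Thm. 6.4.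
* [Dodson1984] B. Dodson, *The structure of Galois groups of CM-fields*, Trans. AMS 283 (1984), §3.2.1 (primitive
  degenerate types on `⟨ρ⟩ × ℤ_n`, `n` composite; the induction device is not there).
-/

noncomputable section

open CategoryTheory CategoryTheory.Limits NumberField

namespace Summit.HodgeConjecture.CorCM.AbelianOddPart

open Literature.NumberTheory.ComplexMultiplication
open Literature.AlgebraicGeometry.Motives (AbelianVariety CMType)
open Literature.AlgebraicGeometry.HodgeTheory
open Literature.AlgebraicGeometry.ComplexMultiplication (IsCMTypeRealisation isSimple_iff_isPrimitive)
open Literature.AlgebraicGeometry.Pohlmann1968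
open Literature.Barriers.HodgeConjecture (divisorClassesSpan)
open Summit.HodgeConjecture.CorCM.GaloisOctic (embOf_complexConj_mul)
open Summit.HodgeConjecture.CorCM.AbelianSixteen (exists_simple_realisation_of_isPrimitive)

open scoped Classical

/-! ## §1 The group-level induction, character form -/

section Group

variable {G : Type*} [CommGroup G] [Fintype G]

/-- **SUBGROUP INDUCTION, character form (group level).**  Let `G' ≤ G` be a subgroup of a finite commutative
group containing `c`, `T₀, T₁ ⊆ G'` CM sets for `c` on `G'` (`x ∈ Tᵢ ↔ c x ∉ Tᵢ` for `x ∈ G'`), `T₀` with trivial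
stabiliser in `G'` and not a `G'`-translate of `T₁`, and `χ` a character of `G` with `Σ_{T₀} χ = Σ_{T₁} χ = 0`.
Then the set `T = T₀ ∪ ⋃_{q ≠ 1} r_q T₁` (`r_q` fixed coset representatives of `G/G'`) is a CM set for `c` on
`G` with TRIVIAL stabiliser and `Σ_T χ = 0`. [cite: Kubota1965, §4 Lemma 2] -/
theorem exists_finset_of_subgroup_char (G' : Subgroup G) {c : G} (hc : c ∈ G') (T₀ T₁ : Finset G)
    (hT₀ : ∀ x ∈ T₀, x ∈ G') (hT₁ : ∀ x ∈ T₁, x ∈ G')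
    (hcm₀ : ∀ x ∈ G', x ∈ T₀ ↔ c * x ∉ T₀) (hcm₁ : ∀ x ∈ G', x ∈ T₁ ↔ c * x ∉ T₁)
    (hprim : ∀ v ∈ G', v ≠ 1 → ∃ w : G, ¬ (w ∈ T₀ ↔ v * w ∈ T₀))
    (hntr : ∀ d ∈ G', ∃ w : G, ¬ (w ∈ T₁ ↔ d * w ∈ T₀))
    (χ : AddChar (Additive G) ℂ) (hχ₀ : ∑ x ∈ T₀, χ (Additive.ofMul x) = 0)
    (hχ₁ : ∑ x ∈ T₁, χ (Additive.ofMul x) = 0) :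
    ∃ T : Finset G, (∀ g : G, g ∈ T ↔ c * g ∉ T) ∧ (∀ v : G, v ≠ 1 → ∃ w : G, ¬ (w ∈ T ↔ v * w ∈ T)) ∧
      ∑ g ∈ T, χ (Additive.ofMul g) = 0 := by
  -- coset representatives
  set rep : G ⧸ G' → G := fun q => Quotient.out q with hrep_def
  have hrep : ∀ q : G ⧸ G', ((rep q : G) : G ⧸ G') = q := fun q => QuotientGroup.out_eq' q
  have hrg : ∀ g : G, (rep (g : G ⧸ G'))⁻¹ * g ∈ G' := fun g => QuotientGroup.eq.1 (hrep _)
  -- membership in `G'` is stable under `G'`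
  have hmulG : ∀ {a b : G}, a ∈ G' → (a * b ∈ G' ↔ b ∈ G') := fun {a b} ha =>
    ⟨fun h => by
      have h' := G'.mul_mem (G'.inv_mem ha) h
      rwa [inv_mul_cancel_left] at h', fun h => G'.mul_mem ha h⟩
  -- the induced set
  set T : Finset G := Finset.univ.filter fun g : G =>
    (g ∈ G' ∧ g ∈ T₀) ∨ (g ∉ G' ∧ (rep (g : G ⧸ G'))⁻¹ * g ∈ T₁) with hT_def
  have hmemT : ∀ g : G, g ∈ T ↔ (g ∈ G' ∧ g ∈ T₀) ∨ (g ∉ G' ∧ (rep (g : G ⧸ G'))⁻¹ * g ∈ T₁) :=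
    fun g => by simp only [hT_def, Finset.mem_filter, Finset.mem_univ, true_and]
  have hmem_in : ∀ g ∈ G', g ∈ T ↔ g ∈ T₀ := fun g hg => by
    rw [hmemT]
    exact ⟨fun h => h.elim (fun h => h.2) (fun h => absurd hg h.1), fun h => Or.inl ⟨hg, h⟩⟩
  have hmem_out : ∀ g ∉ G', g ∈ T ↔ (rep (g : G ⧸ G'))⁻¹ * g ∈ T₁ := fun g hg => by
    rw [hmemT]
    exact ⟨fun h => h.elim (fun h => absurd h.1 hg) (fun h => h.2), fun h => Or.inr ⟨hg, h⟩⟩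
  refine ⟨T, fun g => ?_, fun v hv => ?_, ?_⟩
  · -- CM set for `c`
    by_cases hg : g ∈ G'
    · rw [hmem_in g hg, hmem_in _ (G'.mul_mem hc hg)]
      exact hcm₀ g hg
    · have hcg : c * g ∉ G' := fun h => hg ((hmulG hc).1 h)
      have hq : ((c * g : G) : G ⧸ G') = (g : G ⧸ G') := by
        rw [QuotientGroup.mk_mul, (QuotientGroup.eq_one_iff c).2 hc, one_mul]
      rw [hmem_out g hg, hmem_out _ hcg, hq, mul_left_comm]
      exact hcm₁ _ (hrg g)
  · -- trivial stabiliser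
    by_cases hvG : v ∈ G'
    · obtain ⟨w, hw⟩ := hprim v hvG hv
      have hwG : w ∈ G' := by
        by_contra hwG
        have hvw : v * w ∉ G' := fun h => hwG ((hmulG hvG).1 h)
        exact hw (iff_of_false (fun h => hwG (hT₀ w h)) (fun h => hvw (hT₀ _ h)))
      refine ⟨w, fun h => hw ?_⟩
      rwa [hmem_in w hwG, hmem_in _ (G'.mul_mem hvG hwG)] at h
    · set r : G := rep (v : G ⧸ G') with hr
      have hrv : r⁻¹ * v ∈ G' := hrg v
      have hd : v⁻¹ * r ∈ G' := by
        have h := G'.inv_mem hrv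
        rwa [mul_inv_rev, inv_inv] at h
      obtain ⟨w', hw'⟩ := hntr (v⁻¹ * r) hd
      have hw'G : w' ∈ G' := by
        by_contra hw'G
        have h2 : v⁻¹ * r * w' ∉ G' := fun h => hw'G ((hmulG hd).1 h)
        exact hw' (iff_of_false (fun h => hw'G (hT₁ w' h)) (fun h => h2 (hT₀ _ h)))
      refine ⟨v⁻¹ * r * w', fun h => hw' ?_⟩
      have hrG : r ∉ G' := by
        intro h
        have h' := G'.mul_mem h hrv
        rw [mul_inv_cancel_left] at h'
        exact hvG h'
      have hvw : v * (v⁻¹ * r * w') = r * w' := by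
        rw [← mul_assoc, ← mul_assoc, mul_inv_cancel, one_mul]
      have hrw'G : r * w' ∉ G' := by
        intro h
        have h' := G'.mul_mem h (G'.inv_mem hw'G)
        rw [mul_inv_cancel_right] at h'
        exact hrG h'
      have hq : ((r * w' : G) : G ⧸ G') = (v : G ⧸ G') := by
        rw [QuotientGroup.mk_mul, (QuotientGroup.eq_one_iff w').2 hw'G, mul_one, hr, hrep]
      rw [hmem_in _ (G'.mul_mem hd hw'G), hvw, hmem_out _ hrw'G, hq, ← hr, inv_mul_cancel_left] at h
      exact h.symm
  · -- the character sum: `T₀` on `G'`, translates of `T₁` on the other cosets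
    rw [← Finset.sum_filter_add_sum_filter_not T (fun g => g ∈ G') (fun g => χ (Additive.ofMul g))]
    have hin : T.filter (fun g => g ∈ G') = T₀ := by
      ext g
      simp only [Finset.mem_filter]
      constructor
      · rintro ⟨hgT, hg⟩
        exact (hmem_in g hg).1 hgT
      · intro hg0
        exact ⟨(hmem_in g (hT₀ g hg0)).2 hg0, hT₀ g hg0⟩
    have hout : ∑ g ∈ T.filter (fun g => g ∉ G'), χ (Additive.ofMul g) = 0 := by
      rw [← Finset.sum_fiberwise_of_maps_to (s := T.filter (fun g => g ∉ G')) (t := Finset.univ)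
        (g := fun g : G => (g : G ⧸ G')) (fun _ _ => Finset.mem_univ _)]
      refine Finset.sum_eq_zero fun q _ => ?_
      by_cases hq : q = 1
      · refine Finset.sum_eq_zero fun g hg => ?_
        simp only [Finset.mem_filter] at hg
        exact absurd ((QuotientGroup.eq_one_iff g).1 (hg.2.trans hq)) hg.1.2
      · have hrq : rep q ∉ G' := fun h => hq (by rw [← hrep q]; exact (QuotientGroup.eq_one_iff _).2 h)
        have hfib : ((T.filter fun g : G => g ∉ G').filter fun g : G => (g : G ⧸ G') = q) =
            T₁.image (fun x : G => rep q * x) := by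
          ext g
          rw [Finset.mem_filter, Finset.mem_filter, Finset.mem_image]
          constructor
          · rintro ⟨⟨hgT, hgG⟩, hgq⟩
            refine ⟨(rep q)⁻¹ * g, ?_, mul_inv_cancel_left _ _⟩
            have h := (hmem_out g hgG).1 hgT
            rwa [hgq] at h
          · rintro ⟨x, hx, rfl⟩
            have hxG : x ∈ G' := hT₁ x hx
            have hgq : ((rep q * x : G) : G ⧸ G') = q := by
              rw [QuotientGroup.mk_mul, (QuotientGroup.eq_one_iff x).2 hxG, mul_one, hrep]
            have hgG : rep q * x ∉ G' := fun h => hrq (by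
              have h' := G'.mul_mem h (G'.inv_mem hxG)
              rwa [mul_inv_cancel_right] at h')
            refine ⟨⟨(hmem_out _ hgG).2 ?_, hgG⟩, hgq⟩
            rw [hgq, inv_mul_cancel_left]
            exact hx
        rw [hfib, Finset.sum_image fun x _ y _ h => mul_left_cancel h]
        simp_rw [ofMul_mul, AddChar.map_add_eq_mul]
        rw [← Finset.mul_sum, hχ₁, mul_zero]
    rw [hin, hout, hχ₀, add_zero]

end Group

/-! ## §2 Galois CM fields with commutative Galois group: a CM set with trivial stabiliser killed by an odd
character is a primitive degenerate CM type (Kubota) -/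

section Field

variable {K : Type} [Field K] [NumberField K] [IsCMField K]

/-- Complex conjugation of a CM field, read in `Gal(K/ℚ)`, is intertwined with complex conjugation of `ℂ` by
EVERY embedding. [cite: Shimura1998, §18.2 Lemma (i)] -/
theorem apply_complexConj_eq_conj (φ₀ : K →+* ℂ) (x : K) :
    φ₀ ((IsCMField.complexConj K).restrictScalars ℚ x) = starRingEnd ℂ (φ₀ x) := by
  rw [AlgEquiv.restrictScalars_apply]
  exact IsCMField.complexEmbedding_complexConj K φ₀ x

/-- **CM sets on `Gal(K/ℚ)` killed by an odd character ⟹ primitive degenerate CM types** (`K/ℚ` Galois CM with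
commutative Galois group).  Let `T ⊆ Gal(K/ℚ)` satisfy `g ∈ T ↔ cg ∉ T` and have trivial stabiliser, and let `χ`
be a character with `χ(c) = −1` and `Σ_{g ∈ T} χ(g) = 0`.  Then `Φ = {σ_g : g ∈ T}` (`σ_g = φ₀ ∘ g⁻¹`) is a
PRIMITIVE CM type of `K` (Shimura §8.2 Prop. 26 as `isPrimitive_iff_forall_eq`: the `Aut(ℂ)`-translates act by
translations on `Gal(K/ℚ)`), DEGENERATE by Kubota's Lemma 2 (`rank = 1 + #{odd χ non-vanishing on Φ}`, tree
`Pohlmann1968.isNondegenerate_iff_forall_oddCharacters`). [cite: Kubota1965, §4 Lemma 2]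
[cite: Shimura1998, §8.1, §8.2 Prop. 26] -/
theorem exists_isPrimitive_not_isNondegenerate_of_galoisFinset_char [IsGalois ℚ K]
    (hcomm : ∀ g h : K ≃ₐ[ℚ] K, g * h = h * g) (T : Finset (K ≃ₐ[ℚ] K))
    (hcm : ∀ g : K ≃ₐ[ℚ] K, g ∈ T ↔ (IsCMField.complexConj K).restrictScalars ℚ * g ∉ T)
    (hprim : ∀ v : K ≃ₐ[ℚ] K, v ≠ 1 → ∃ w : K ≃ₐ[ℚ] K, ¬ (w ∈ T ↔ v * w ∈ T))
    (χ : AddChar (Additive (K ≃ₐ[ℚ] K)) ℂ)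
    (hχc : χ (Additive.ofMul ((IsCMField.complexConj K).restrictScalars ℚ)) = -1)
    (hχT : ∑ g ∈ T, χ (Additive.ofMul g) = 0) (φ₀ : K →+* ℂ) :
    ∃ Φ : CMType K, IsPrimitive (ℂ ≃+* ℂ) Φ.1 φ₀ ∧ ¬ IsNondegenerate Φ ∧
      ∀ g : K ≃ₐ[ℚ] K, embOf φ₀ g ∈ Φ.1 ↔ g ∈ T := by
  haveI := isPretransitive_ringEquiv_complex (K := K)
  set c : K ≃ₐ[ℚ] K := (IsCMField.complexConj K).restrictScalars ℚ with hc_def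
  have hEinj : Function.Injective (embOf φ₀) := (embOf_bijective φ₀).1
  have hEsurj : Function.Surjective (embOf φ₀) := (embOf_bijective φ₀).2
  -- the CM type `Φ = σ(T)`
  set S : Set (K →+* ℂ) := embOf φ₀ '' (T : Set (K ≃ₐ[ℚ] K)) with hS_def
  have hmemE : ∀ g, embOf φ₀ g ∈ S ↔ g ∈ T := fun g => by
    rw [hS_def, hEinj.mem_set_image, Finset.mem_coe]
  have hcm' : ∀ φ, φ ∈ S ↔ ComplexEmbedding.conjugate φ ∉ S := by
    intro φ
    obtain ⟨g, rfl⟩ := hEsurj φ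
    rw [← embOf_complexConj_mul, hmemE, hmemE]
    exact hcm g
  let Φ : CMType K := ⟨S, hcm'⟩
  refine ⟨Φ, ?_, ?_, fun g => hmemE g⟩
  · -- primitive: the translates separate the embeddings
    rw [isPrimitive_iff_forall_eq]
    intro φ₁ φ₂ hsep
    obtain ⟨g₁, rfl⟩ := hEsurj φ₁
    obtain ⟨g₂, rfl⟩ := hEsurj φ₂
    by_contra hne
    have hv : g₂ * g₁⁻¹ ≠ 1 := fun h => hne (by rw [mul_inv_eq_one] at h; rw [h])
    obtain ⟨w, hw⟩ := hprim _ hv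
    obtain ⟨τ, hτ⟩ := exists_ringEquiv_comp_eq_algEquiv φ₀ (w⁻¹ * g₁)
    have h := hsep τ
    have h1 : g₁ * (w⁻¹ * g₁)⁻¹ = w := by rw [mul_inv_rev, inv_inv, mul_inv_cancel_left]
    have h2 : g₂ * (w⁻¹ * g₁)⁻¹ = g₂ * g₁⁻¹ * w := by rw [mul_inv_rev, inv_inv, mul_assoc]
    rw [smul_embOf_of_comp φ₀ hτ, smul_embOf_of_comp φ₀ hτ, h1, h2] at h
    exact hw ((hmemE w).symm.trans (h.trans (hmemE _)))
  · -- degenerate: the odd character `χ` vanishes on `{g | σ_g ∈ Φ} = T` (Kubota's Lemma 2)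
    rw [isNondegenerate_iff_forall_oddCharacters hcomm Φ φ₀ c (apply_complexConj_eq_conj φ₀), not_forall]
    refine ⟨χ, fun h => h hχc ?_⟩
    have hfilter : (Finset.univ.filter fun g : K ≃ₐ[ℚ] K => embOf φ₀ g ∈ Φ.1) = T := by
      ext g
      simp only [Finset.mem_filter, Finset.mem_univ, true_and]
      exact hmemE g
    rw [hfilter, hχT]

/-! ## §3 Subgroups of the Galois group -/

/-- **SUBGROUP INDUCTION, character form (field level).**  `K/ℚ` Galois CM with COMMUTATIVE Galois group;
`G' ≤ Gal(K/ℚ)` a subgroup containing complex conjugation `c`; `T₀, T₁ ⊆ G'` CM sets for `c` on `G'`, `T₀` with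
trivial stabiliser in `G'` and not a `G'`-translate of `T₁`; `χ` an ODD character of `Gal(K/ℚ)` (`χ(c) = −1`)
vanishing on `T₀` and on `T₁`.  Then `K` has a PRIMITIVE DEGENERATE CM type.  (Inflating a degenerate type from a
CM SUBFIELD loses primitivity; inducing from the SUBGROUP `G' ∋ c` does not, and the vanishing of `χ` is inherited
coset by coset.) [cite: Kubota1965, §4 Lemma 2] [cite: Shimura1998, §8.1, §8.2 Prop. 26] -/
theorem exists_isPrimitive_not_isNondegenerate_of_subgroup_char [IsGalois ℚ K]
    (hcomm : ∀ g h : K ≃ₐ[ℚ] K, g * h = h * g) (G' : Subgroup (K ≃ₐ[ℚ] K))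
    (hc : (IsCMField.complexConj K).restrictScalars ℚ ∈ G') (T₀ T₁ : Finset (K ≃ₐ[ℚ] K))
    (hT₀ : ∀ x ∈ T₀, x ∈ G') (hT₁ : ∀ x ∈ T₁, x ∈ G')
    (hcm₀ : ∀ x ∈ G', x ∈ T₀ ↔ (IsCMField.complexConj K).restrictScalars ℚ * x ∉ T₀)
    (hcm₁ : ∀ x ∈ G', x ∈ T₁ ↔ (IsCMField.complexConj K).restrictScalars ℚ * x ∉ T₁)
    (hprim : ∀ v ∈ G', v ≠ 1 → ∃ w : K ≃ₐ[ℚ] K, ¬ (w ∈ T₀ ↔ v * w ∈ T₀))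
    (hntr : ∀ d ∈ G', ∃ w : K ≃ₐ[ℚ] K, ¬ (w ∈ T₁ ↔ d * w ∈ T₀))
    (χ : AddChar (Additive (K ≃ₐ[ℚ] K)) ℂ)
    (hχc : χ (Additive.ofMul ((IsCMField.complexConj K).restrictScalars ℚ)) = -1)
    (hχ₀ : ∑ x ∈ T₀, χ (Additive.ofMul x) = 0) (hχ₁ : ∑ x ∈ T₁, χ (Additive.ofMul x) = 0) (φ₀ : K →+* ℂ) :
    ∃ Φ : CMType K, IsPrimitive (ℂ ≃+* ℂ) Φ.1 φ₀ ∧ ¬ IsNondegenerate Φ := by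
  letI : CommGroup (K ≃ₐ[ℚ] K) := { (inferInstance : Group (K ≃ₐ[ℚ] K)) with mul_comm := hcomm }
  obtain ⟨T, hcmT, hprimT, hχT⟩ :=
    exists_finset_of_subgroup_char G' hc T₀ T₁ hT₀ hT₁ hcm₀ hcm₁ hprim hntr χ hχ₀ hχ₁
  obtain ⟨Φ, hΦprim, hΦdeg, -⟩ :=
    exists_isPrimitive_not_isNondegenerate_of_galoisFinset_char hcomm T hcmT hprimT χ hχc hχT φ₀
  exact ⟨Φ, hΦprim, hΦdeg⟩

/-- **Realisation form**: under the hypotheses of `exists_isPrimitive_not_isNondegenerate_of_subgroup_char` there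
is a SIMPLE abelian variety of dimension `[K:ℚ]/2` with complex multiplication by `K` (Shimura's existence theorem,
tree `cmAbelianVarietyRealised_holds`; simple ⟺ primitive, Shimura §8.2 Prop. 26) whose CM type is DEGENERATE,
carrying an exceptional Hodge class — rational, of type `(m,m)`, outside the complexified divisor ring — on some
power (Hazama/Pohlmann, tree `exists_exceptional_pow_of_not_isNondegenerate`). [cite: Shimura1998, §6.2 Thm. 3
and §8.2 Prop. 26] [cite: Gordon1999HodgeAVSurvey, Thm. 6.4] [cite: Kubota1965, §4 Lemma 2] -/
theorem exists_simple_degenerate_of_subgroup_char [IsGalois ℚ K]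
    (hcomm : ∀ g h : K ≃ₐ[ℚ] K, g * h = h * g) (G' : Subgroup (K ≃ₐ[ℚ] K))
    (hc : (IsCMField.complexConj K).restrictScalars ℚ ∈ G') (T₀ T₁ : Finset (K ≃ₐ[ℚ] K))
    (hT₀ : ∀ x ∈ T₀, x ∈ G') (hT₁ : ∀ x ∈ T₁, x ∈ G')
    (hcm₀ : ∀ x ∈ G', x ∈ T₀ ↔ (IsCMField.complexConj K).restrictScalars ℚ * x ∉ T₀)
    (hcm₁ : ∀ x ∈ G', x ∈ T₁ ↔ (IsCMField.complexConj K).restrictScalars ℚ * x ∉ T₁)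
    (hprim : ∀ v ∈ G', v ≠ 1 → ∃ w : K ≃ₐ[ℚ] K, ¬ (w ∈ T₀ ↔ v * w ∈ T₀))
    (hntr : ∀ d ∈ G', ∃ w : K ≃ₐ[ℚ] K, ¬ (w ∈ T₁ ↔ d * w ∈ T₀))
    (χ : AddChar (Additive (K ≃ₐ[ℚ] K)) ℂ)
    (hχc : χ (Additive.ofMul ((IsCMField.complexConj K).restrictScalars ℚ)) = -1)
    (hχ₀ : ∑ x ∈ T₀, χ (Additive.ofMul x) = 0) (hχ₁ : ∑ x ∈ T₁, χ (Additive.ofMul x) = 0) :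
    ∃ (Φ : CMType K) (φ₀ : K →+* ℂ) (A : AbelianVariety ℂ) (ι : 𝓞 K →+* End A)
      (θ : K →+* Module.End ℂ (complexBetti A.X 1)),
      IsPrimitive (ℂ ≃+* ℂ) Φ.1 φ₀ ∧ ¬ IsNondegenerate Φ ∧ IsCMTypeRealisation Φ A ι θ ∧ A.IsSimple ∧
      A.dim = Module.finrank ℚ K / 2 ∧
      ∃ n m : ℕ, ∃ x : complexBetti (⨁ fun _ : Fin n => A).X (2 * m), IsRationalClass x ∧
        IsOfHodgeType (⨁ fun _ : Fin n => A).dim (⨁ fun _ : Fin n => A).X (2 * m) m m x ∧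
        x ∉ divisorClassesSpan (⨁ fun _ : Fin n => A).X (⨁ fun _ : Fin n => A).dim m := by
  obtain ⟨φ₀⟩ := (inferInstance : Nonempty (K →+* ℂ))
  obtain ⟨Φ, hprimΦ, hdeg⟩ := exists_isPrimitive_not_isNondegenerate_of_subgroup_char hcomm G' hc T₀ T₁
    hT₀ hT₁ hcm₀ hcm₁ hprim hntr χ hχc hχ₀ hχ₁ φ₀
  obtain ⟨A, ι, θ, hA, hs, hdim⟩ := exists_simple_realisation_of_isPrimitive Φ φ₀ hprimΦ
  exact ⟨Φ, φ₀, A, ι, θ, hprimΦ, hdeg, hA, hs, hdim,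
    exists_exceptional_pow_of_not_isNondegenerate φ₀ hprimΦ hdeg hA⟩

end Field

end Summit.HodgeConjecture.CorCM.AbelianOddPart

end
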